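import Literature.AnabelianGeometry.EtaleTheta.Discharge.Sec2InvEllOfCLevel
import Literature.AnabelianGeometry.EtaleTheta.SettingModelMuTwoInversionCLevel
import HarnessLib

/-!
# [EtTh] §2 over §1: the eigenvalue `−1` binder at abc-iut-w5-d072's C-level datum of the inversion model
# — `ε̂_±` itself is the geometric witness; joint-satisfiability headline (GAP-LEDGER G-L2t10-4 (a))

S. Mochizuki, *The étale theta function and its Frobenioid-theoretic manifestations*, Publ. RIMS **45**
(2009) [EtTh], §2 p. 36 (printed 262) «`ι` … “multiplication by `−1`”»; Prop. 2.2 (i) p. 37 «eigenvalues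
`−1` and `1`» [cite: MochizukiEtTh2009, Prop 2.2 (i) p.37].

Cell abc-iut, layer L2, seat abc-iut-L2-t10 (gen 5). Sequel to `Discharge/Sec2InvEllOfCLevel` (p432126),
whose §4 is generic over `e : (MuTwoSetting.inversionModel p).CLevelData`. Here the SPECIFIC C-level datum
`MuTwoSetting.inversionModel_cLevelData p` of `SettingModelMuTwoInversionCLevel` (abc-iut-w5-d072; `augC :=
lift aug 1`) is plugged in: its `ε_±` is GEOMETRIC (`augC ε_± = 1`), so `ε̂_± ∈ Ker(Π_C ↠ G_K) ∖ Π_X` is an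
explicit witness, and the existential headline **`MuTwoSetting.exists_cLevelData_piCData_inv_ell_deltaX`**
records that the [EtTh] Def. 1.7 interface with the origin guard, C-level data, and — in the resulting
profinite `Π_C ⊇ Π_X ↠ G_K` — the `Δ_X`-form of the binder `hιell` («`ι` acts on `Δ̄^ell_X` by `−1`») are
JOINTLY SATISFIABLE (consistency evidence; at abc-iut-L2-t1's product model the clause fails for every
C-level datum, `not_hinv_conjX_epsPM_model`). PROOF-ONLY (0 definitions); nothing of [EtTh] is asserted; no
side is taken on [IUTchIII] Cor. 3.12; typed ≠ proved; a model is consistency evidence only.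
-/

noncomputable section

namespace Literature.AnabelianGeometry.EtaleTheta.SettingModel

open Literature.AnabelianGeometry.SemiGraphs _root_.Topology

variable (p : ℕ) [Fact p.Prime]

/-- At abc-iut-w5-d072's C-level datum of the inversion model, `ε_±` is GEOMETRIC: `augC ε_± = 1`
(`augC = lift aug 1` and `ε_± = inr 1̄`). [cite: MochizukiEtTh2009, §2 p.36] -/
theorem augC_epsPM_inversionModel_cLevelData :
    (MuTwoSetting.inversionModel_cLevelData p).augC (MuTwoSetting.inversionModel p).epsPM = 1 := by
  change augCInv p (epsPMInv p) = 1
  rw [augCInv_apply, epsPMInv, SemidirectProduct.left_inr, map_one]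

/-- Hence `ε̂_± ∈ Ker(Π_C ↠ G_K)` in the profinite `Π_C` of that datum. [cite: MochizukiEtTh2009, §2 p.36] -/
theorem toPiCHat_epsPM_mem_ker_inversionModel_cLevelData :
    (MuTwoSetting.inversionModel_cLevelData p).toPiCHat (MuTwoSetting.inversionModel p).epsPM ∈
      (MuTwoSetting.inversionModel_cLevelData p).piCData.augGK.ker := by
  rw [MuTwoSetting.CLevelData.piCData, MuTwoSetting.CLevelData.piCDataOf_ιC_mem_ker_augGK_iff]
  exact augC_epsPM_inversionModel_cLevelData p

/-- … and `ε̂_± ∉ Π_X` there: `ε̂_±` is an explicit GEOMETRIC element of `Π_C ∖ Π_X`.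
[cite: MochizukiEtTh2009, §2 p.36] -/
theorem toPiCHat_epsPM_geometric_inversionModel_cLevelData :
    (MuTwoSetting.inversionModel_cLevelData p).toPiCHat (MuTwoSetting.inversionModel p).epsPM ∈
        (MuTwoSetting.inversionModel_cLevelData p).piCData.augGK.ker ∧
      (MuTwoSetting.inversionModel_cLevelData p).toPiCHat (MuTwoSetting.inversionModel p).epsPM ∉
        (MuTwoSetting.inversionModel_cLevelData p).piCData.PiX :=
  ⟨toPiCHat_epsPM_mem_ker_inversionModel_cLevelData p,
    inversionModel_toPiCHat_epsPM_not_mem_PiX p (MuTwoSetting.inversionModel_cLevelData p)⟩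

/-- **The consumer-shaped pointwise law at `c := ε̂_±`** for that datum: `ε̂_± ∈ Ker(Π_C ↠ G_K)`, `ε̂_± ∉ Π_X`,
and `ε̂_± · d · ε̂_±⁻¹ · d ∈ barTheta l` for every `d ∈ Δ_X`. [cite: MochizukiEtTh2009, Prop 2.2 (i) p.37] -/
theorem epsPM_inv_ell_deltaX_inversionModel_cLevelData (l : ℕ) :
    let e := MuTwoSetting.inversionModel_cLevelData p
    let c := e.toPiCHat (MuTwoSetting.inversionModel p).epsPM
    c ∈ e.piCData.augGK.ker ∧ c ∉ e.piCData.PiX ∧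
      ∀ d ∈ e.piCData.DeltaX, c * d * c⁻¹ * d ∈ e.piCData.barTheta l :=
  ⟨toPiCHat_epsPM_mem_ker_inversionModel_cLevelData p,
    inversionModel_toPiCHat_epsPM_not_mem_PiX p _,
    inversionModel_piCData_epsPM_conj_mul_mem_barTheta p _ l⟩

/-- **JOINT SATISFIABILITY (GAP-LEDGER G-L2t10-4 (a), census headline).** There are a Def. 1.7 setting `M`
with the origin guard `IsEtThOrigin` and an admissible `ε_Z`, C-level data `e`, and — in the profinite
`Π_C ⊇ Π_X ↠ G_K` built from them (`e.piCData`) — a GEOMETRIC `c ∈ Ker(Π_C ↠ G_K) ∖ Π_X`, such that EVERY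
`c ∉ Π_X` satisfies `c · d · c⁻¹ · d ∈ barTheta l` for all `d ∈ Δ_X` (the `Δ_X`-form of the binder `hιell`
of `PiCData.coverDataAx`). Witness: the inversion model with abc-iut-w5-d072's C-level datum.
[cite: MochizukiEtTh2009, Prop 2.2 (i) p.37] -/
theorem _root_.Literature.AnabelianGeometry.EtaleTheta.MuTwoSetting.exists_cLevelData_piCData_inv_ell_deltaX
    (l : ℕ) :
    ∃ (M : MuTwoSetting p) (e : M.CLevelData), M.toThetaSetting.IsEtThOrigin ∧
      (∃ εZ : M.GtpC, M.IsAdmissibleEpsZ εZ) ∧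
      (∃ c : e.PiCHat, c ∈ e.piCData.augGK.ker ∧ c ∉ e.piCData.PiX) ∧
      ∀ c : e.PiCHat, c ∉ e.piCData.PiX → ∀ d ∈ e.piCData.DeltaX, c * d * c⁻¹ * d ∈ e.piCData.barTheta l :=
  ⟨MuTwoSetting.inversionModel p, MuTwoSetting.inversionModel_cLevelData p,
    MuTwoSetting.inversionModel_isEtThOrigin p, ⟨_, MuTwoSetting.inversionModel_isAdmissibleEpsZ p⟩,
    ⟨_, toPiCHat_epsPM_geometric_inversionModel_cLevelData p⟩,
    inversionModel_piCData_inv_ell_deltaX p _ l⟩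

end Literature.AnabelianGeometry.EtaleTheta.SettingModel

end
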